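import Summits.Ventures.YMGap.RobustBall.HaarSecondMoments
import HarnessLib

/-!
# Route `ToronCumulantSign`, crux `CommutatorSkewMoment` (stmt-QuantumFields-27530) — helper I:
# phase-twist vanishing of the bidegree-(2,2) Haar monomials of `SU(N)`, every `N ≥ 2`

For a compact group `G ≅ SU(N)` (`IsSpecialUnitaryModel ρ`, the tree's standing hypothesis) and the general monomial
`𝔪 = ρ_{r₁c₁} ρ_{r₂c₂} conj(ρ_{r₃c₃}) conj(ρ_{r₄c₄})`, the Haar integral `∫ 𝔪` VANISHES unless the row multisets agree,
`{r₁, r₂} = {r₃, r₄}`, and the column multisets agree, `{c₁, c₂} = {c₃, c₄}` (the support of the second Weingarten function,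
Collins–Śniady 2006 Cor. 2.4 / Creutz (8.22)).  Proof WITHOUT Weingarten calculus, by invariance alone: left (resp. right)
multiplication by the diagonal phase `diag(ζ at a, ζ⁴ at b, 1 elsewhere) ∈ SU(N)`, `ζ = e^{2πi/5}`, multiplies `𝔪` by `ζ^E` with an
exponent `E ∈ ℕ` that is NOT a multiple of `5` for a suitable pair `a ≠ b` whenever the multisets differ (a fifth root of unity
instead of the tree's `± i` twists makes a spare third index unnecessary, so `N = 2` is included).  HONEST LABEL: pure
compact-group integration; a helper toward the OPEN crux `CommutatorSkewMoment`; nothing about the Yang–Mills mass gap.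

References: B. Collins, P. Śniady, CMP 264 (2006) 773–795, Cor. 2.4; M. Creutz, *Quarks, gluons and lattices* (1983) §8.
-/

noncomputable section

open MeasureTheory Complex
open Literature.MathematicalPhysics.QuantumLattice Literature.MathematicalPhysics.QuantumFieldTheory

namespace Summit.QuantumFields.YangMills.Theorems.ToronCumulantSign

open Summit.Ventures.YMGap.RobustBall.HaarSecondMoments (integral_comp_mul_left integral_comp_mul_right)

/-! ### The fifth root of unity `ζ` and the diagonal twist -/

/-- Local shorthand: `ζ = e^{2πi/5}`. -/
local notation3 (prettyPrint := false) "ζ₅" => Complex.exp (2 * Real.pi * Complex.I / 5)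

/-- `ζ` is a primitive fifth root of unity. [folklore] -/
theorem zeta5_isPrimitiveRoot : IsPrimitiveRoot ζ₅ 5 := by
  simpa using Complex.isPrimitiveRoot_exp 5 (by norm_num)

/-- `ζ^k = 1 ↔ 5 ∣ k`. [folklore] -/
theorem zeta5_pow_eq_one_iff (k : ℕ) : ζ₅ ^ k = 1 ↔ 5 ∣ k :=
  zeta5_isPrimitiveRoot.pow_eq_one_iff_dvd k

/-- `conj ζ = ζ⁴`. [folklore] -/
theorem conj_zeta5 : (starRingEnd ℂ) ζ₅ = ζ₅ ^ 4 := by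
  have h1 : ‖ζ₅‖ = 1 := zeta5_isPrimitiveRoot.norm'_eq_one (by norm_num)
  have h5 : ζ₅ ^ 5 = 1 := zeta5_isPrimitiveRoot.pow_eq_one
  have hne : ζ₅ ≠ 0 := fun h => by rw [h, norm_zero] at h1; exact zero_ne_one h1
  rw [← Complex.inv_eq_conj h1]
  have : ζ₅ ^ 4 * ζ₅ = 1 := by rw [← pow_succ, h5]
  exact (eq_inv_of_mul_eq_one_left this).symm
  
/-- A complex number fixed by multiplication with `c ≠ 1` vanishes. [folklore] -/
theorem eq_zero_of_mul_eq_self' {c z : ℂ} (hc : c ≠ 1) (h : c * z = z) : z = 0 := by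
  have h' : (c - 1) * z = 0 := by rw [sub_mul, one_mul, h, sub_self]
  rcases mul_eq_zero.mp h' with h'' | h''
  · exact absurd (sub_eq_zero.mp h'') hc
  · exact h''

/-- `conj (ζ^k) = ζ^{4k}`. [folklore] -/
theorem conj_zeta5_pow (k : ℕ) : (starRingEnd ℂ) (ζ₅ ^ k) = ζ₅ ^ (4 * k) := by
  rw [map_pow, conj_zeta5, ← pow_mul]

section Twist

variable {N : ℕ} {G : Type*} [Group G] [TopologicalSpace G] [IsTopologicalGroup G] [CompactSpace G]
  [MeasurableSpace G] [BorelSpace G] (ρ : G →* Matrix (Fin N) (Fin N) ℂ)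

/-- Local shorthand: the twist exponent of index `r` under the pair `(a, b)`: `1` at `a`, `4` at `b`, `0` elsewhere. -/
local notation3 (prettyPrint := false) "te" a:max b:max r:max =>
  (if r = a then (1 : ℕ) else if r = b then (4 : ℕ) else (0 : ℕ))

/-- Local shorthand: the diagonal twist `diag(ζ^{te a b r})`. -/
local notation3 (prettyPrint := false) "twist" a:max b:max =>
  (Matrix.diagonal (fun r : Fin N => ζ₅ ^ (te a b r)) : Matrix (Fin N) (Fin N) ℂ)

/-- Local shorthand: the general bidegree-(2,2) monomial `M_{r₁c₁} M_{r₂c₂} conj(M_{r₃c₃}) conj(M_{r₄c₄})`. -/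
local notation3 (prettyPrint := false) "𝔪" M:max r₁:max c₁:max r₂:max c₂:max r₃:max c₃:max r₄:max c₄:max =>
  M r₁ c₁ * M r₂ c₂ * (starRingEnd ℂ) (M r₃ c₃) * (starRingEnd ℂ) (M r₄ c₄)

/-- The sum of the twist exponents over all indices is `5` (`a ≠ b`). [folklore] -/
theorem sum_te {a b : Fin N} (hab : a ≠ b) : ∑ r : Fin N, te a b r = 5 := by
  have h : ∀ r : Fin N, te a b r = (if r = a then 1 else 0) + (if r = b then 4 else 0) := by
    intro r
    by_cases hra : r = a
    · subst hra; simp [hab]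
    · simp [hra]
  simp_rw [h]
  rw [Finset.sum_add_distrib, Finset.sum_ite_eq' Finset.univ a, Finset.sum_ite_eq' Finset.univ b]
  simp

/-- The diagonal twist lies in `SU(N)` (`a ≠ b`): its entries are unimodular and its determinant is `ζ^5 = 1`. [folklore] -/
theorem twist_mem {a b : Fin N} (hab : a ≠ b) : twist a b ∈ Matrix.specialUnitaryGroup (Fin N) ℂ := by
  rw [Matrix.mem_specialUnitaryGroup_iff]
  refine ⟨?_, ?_⟩
  · rw [Matrix.mem_unitaryGroup_iff, Matrix.star_eq_conjTranspose, Matrix.diagonal_conjTranspose,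
      Matrix.diagonal_mul_diagonal, ← Matrix.diagonal_one]
    congr 1
    funext r
    simp only [Pi.star_apply, Complex.star_def]
    rw [conj_zeta5_pow, ← pow_add, zeta5_pow_eq_one_iff]
    exact ⟨te a b r, by ring⟩
  · rw [Matrix.det_diagonal, Finset.prod_pow_eq_pow_sum, sum_te hab]
    exact zeta5_isPrimitiveRoot.pow_eq_one

/-- Entries of the left-twisted matrix: `(D M)_{rc} = ζ^{te r} M_{rc}`. [folklore] -/
theorem twist_mul_apply (a b : Fin N) (M : Matrix (Fin N) (Fin N) ℂ) (r c : Fin N) :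
    (twist a b * M) r c = ζ₅ ^ (te a b r) * M r c := by
  rw [Matrix.diagonal_mul]

/-- Entries of the right-twisted matrix: `(M D)_{rc} = ζ^{te c} M_{rc}`. [folklore] -/
theorem mul_twist_apply (a b : Fin N) (M : Matrix (Fin N) (Fin N) ℂ) (r c : Fin N) :
    (M * twist a b) r c = ζ₅ ^ (te a b c) * M r c := by
  rw [Matrix.mul_diagonal, mul_comm]

/-- **Row twist relation**: `∫ 𝔪 = ζ^E ∫ 𝔪` with `E = te r₁ + te r₂ + 4 te r₃ + 4 te r₄`; hence `∫ 𝔪 = 0` unless `5 ∣ E`. [folklore] -/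
theorem integral_mono_eq_zero_of_rowTwist (hρ : IsSpecialUnitaryModel ρ) {a b : Fin N} (hab : a ≠ b)
    (r₁ c₁ r₂ c₂ r₃ c₃ r₄ c₄ : Fin N)
    (hE : ¬ 5 ∣ te a b r₁ + te a b r₂ + 4 * te a b r₃ + 4 * te a b r₄) :
    ∫ g, 𝔪 (ρ g) r₁ c₁ r₂ c₂ r₃ c₃ r₄ c₄ ∂haarProbability G = 0 := by
  have h := integral_comp_mul_left ρ hρ (twist_mem hab) (fun M => 𝔪 M r₁ c₁ r₂ c₂ r₃ c₃ r₄ c₄)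
  have hpt : ∀ M : Matrix (Fin N) (Fin N) ℂ, 𝔪 (twist a b * M) r₁ c₁ r₂ c₂ r₃ c₃ r₄ c₄ =
      ζ₅ ^ (te a b r₁ + te a b r₂ + 4 * te a b r₃ + 4 * te a b r₄) * 𝔪 M r₁ c₁ r₂ c₂ r₃ c₃ r₄ c₄ := by
    intro M
    rw [twist_mul_apply, twist_mul_apply, twist_mul_apply, twist_mul_apply, map_mul, map_mul, conj_zeta5_pow,
      conj_zeta5_pow]
    rw [pow_add, pow_add, pow_add]
    ring
  simp only [hpt] at h
  rw [integral_const_mul] at h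
  exact eq_zero_of_mul_eq_self' (fun h1 => hE ((zeta5_pow_eq_one_iff _).mp h1)) h

/-- **Column twist relation**: the same with the column indices (right multiplication). [folklore] -/
theorem integral_mono_eq_zero_of_colTwist (hρ : IsSpecialUnitaryModel ρ) {a b : Fin N} (hab : a ≠ b)
    (r₁ c₁ r₂ c₂ r₃ c₃ r₄ c₄ : Fin N)
    (hE : ¬ 5 ∣ te a b c₁ + te a b c₂ + 4 * te a b c₃ + 4 * te a b c₄) :
    ∫ g, 𝔪 (ρ g) r₁ c₁ r₂ c₂ r₃ c₃ r₄ c₄ ∂haarProbability G = 0 := by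
  have h := integral_comp_mul_right ρ hρ (twist_mem hab) (fun M => 𝔪 M r₁ c₁ r₂ c₂ r₃ c₃ r₄ c₄)
  have hpt : ∀ M : Matrix (Fin N) (Fin N) ℂ, 𝔪 (M * twist a b) r₁ c₁ r₂ c₂ r₃ c₃ r₄ c₄ =
      ζ₅ ^ (te a b c₁ + te a b c₂ + 4 * te a b c₃ + 4 * te a b c₄) * 𝔪 M r₁ c₁ r₂ c₂ r₃ c₃ r₄ c₄ := by
    intro M
    rw [mul_twist_apply, mul_twist_apply, mul_twist_apply, mul_twist_apply, map_mul, map_mul, conj_zeta5_pow,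
      conj_zeta5_pow]
    rw [pow_add, pow_add, pow_add]
    ring
  simp only [hpt] at h
  rw [integral_const_mul] at h
  exact eq_zero_of_mul_eq_self' (fun h1 => hE ((zeta5_pow_eq_one_iff _).mp h1)) h

/-- **Row support of the second moments**: `∫ 𝔪 = 0` unless the row multisets agree, `{r₁, r₂} = {r₃, r₄}`. [folklore] -/
theorem integral_mono_eq_zero_of_rows (hρ : IsSpecialUnitaryModel ρ) (r₁ c₁ r₂ c₂ r₃ c₃ r₄ c₄ : Fin N)
    (h : ¬((r₁ = r₃ ∧ r₂ = r₄) ∨ (r₁ = r₄ ∧ r₂ = r₃))) :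
    ∫ g, 𝔪 (ρ g) r₁ c₁ r₂ c₂ r₃ c₃ r₄ c₄ ∂haarProbability G = 0 := by
  by_cases h12 : r₂ = r₁
  · subst h12
    by_cases h31 : r₃ = r₂
    · subst h31
      -- rows `r r r r₄` with `r₄ ≠ r`: twist `(r, r₄)`, exponent `1 + 1 + 4 + 16 = 22`
      have h4 : r₄ ≠ r₃ := fun h4 => h (Or.inl ⟨rfl, h4.symm⟩)
      refine integral_mono_eq_zero_of_rowTwist ρ hρ (Ne.symm h4) r₃ c₁ r₃ c₂ r₃ c₃ r₄ c₄ ?_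
      simp only [↓reduceIte, h4]; omega
    · -- rows `r r r₃ r₄` with `r₃ ≠ r`: twist `(r, r₃)`
      have h13 : r₂ ≠ r₃ := fun h' => h31 h'.symm
      by_cases h42 : r₄ = r₂
      · subst h42
        refine integral_mono_eq_zero_of_rowTwist ρ hρ h13 r₄ c₁ r₄ c₂ r₃ c₃ r₄ c₄ ?_
        simp only [↓reduceIte, h31]; omega
      · by_cases h43 : r₄ = r₃
        · subst h43
          refine integral_mono_eq_zero_of_rowTwist ρ hρ h13 r₂ c₁ r₂ c₂ r₄ c₃ r₄ c₄ ?_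
          simp only [↓reduceIte, h31]; omega
        · refine integral_mono_eq_zero_of_rowTwist ρ hρ h13 r₂ c₁ r₂ c₂ r₃ c₃ r₄ c₄ ?_
          simp only [↓reduceIte, h31, h42, h43]; omega
  · by_cases h31 : r₃ = r₁
    · subst h31
      -- rows `r₁ r₂ r₁ r₄`, `r₂ ≠ r₁`, and `r₄ ≠ r₂`: twist `(r₂, r₄)`
      have h42 : r₄ ≠ r₂ := fun h' => h (Or.inl ⟨rfl, h'.symm⟩)
      have h24 : r₂ ≠ r₄ := fun h' => h42 h'.symm
      by_cases h41 : r₄ = r₃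
      · subst h41
        refine integral_mono_eq_zero_of_rowTwist ρ hρ h24 r₄ c₁ r₂ c₂ r₄ c₃ r₄ c₄ ?_
        simp only [↓reduceIte, h42]; omega
      · have h14 : r₃ ≠ r₄ := fun h' => h41 h'.symm
        have h12' : r₃ ≠ r₂ := fun h' => h12 h'.symm
        refine integral_mono_eq_zero_of_rowTwist ρ hρ h24 r₃ c₁ r₂ c₂ r₃ c₃ r₄ c₄ ?_
        simp only [↓reduceIte, h42, h14, h12']; omega
    · by_cases h41 : r₄ = r₁
      · subst h41
        -- rows `r₁ r₂ r₃ r₁`, `r₂ ≠ r₁`, `r₃ ≠ r₁`, and `r₃ ≠ r₂`: twist `(r₂, r₃)`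
        have h32 : r₃ ≠ r₂ := fun h' => h (Or.inr ⟨rfl, h'.symm⟩)
        have h23 : r₂ ≠ r₃ := fun h' => h32 h'.symm
        have h42 : r₄ ≠ r₂ := fun h' => h12 h'.symm
        have h43 : r₄ ≠ r₃ := fun h' => h31 h'.symm
        refine integral_mono_eq_zero_of_rowTwist ρ hρ h23 r₄ c₁ r₂ c₂ r₃ c₃ r₄ c₄ ?_
        simp only [↓reduceIte, h32, h42, h43]; omega
      · -- rows `r₁ r₂ r₃ r₄`, `r₃, r₄ ≠ r₁`: twist `(r₁, r₃)`
        have h13 : r₁ ≠ r₃ := fun h' => h31 h'.symm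
        by_cases h23 : r₂ = r₃
        · subst h23
          by_cases h42 : r₄ = r₂
          · subst h42
            refine integral_mono_eq_zero_of_rowTwist ρ hρ h13 r₁ c₁ r₄ c₂ r₄ c₃ r₄ c₄ ?_
            simp only [↓reduceIte, h12]; omega
          · refine integral_mono_eq_zero_of_rowTwist ρ hρ h13 r₁ c₁ r₂ c₂ r₂ c₃ r₄ c₄ ?_
            simp only [↓reduceIte, h12, h41, h42]; omega
        · by_cases h43 : r₄ = r₃
          · subst h43
            refine integral_mono_eq_zero_of_rowTwist ρ hρ h13 r₁ c₁ r₂ c₂ r₄ c₃ r₄ c₄ ?_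
            simp only [↓reduceIte, h12, h23, h41]; omega
          · refine integral_mono_eq_zero_of_rowTwist ρ hρ h13 r₁ c₁ r₂ c₂ r₃ c₃ r₄ c₄ ?_
            simp only [↓reduceIte, h12, h23, h31, h41, h43]; omega

/-- **Column support of the second moments**: `∫ 𝔪 = 0` unless the column multisets agree, `{c₁, c₂} = {c₃, c₄}`. [folklore] -/
theorem integral_mono_eq_zero_of_cols (hρ : IsSpecialUnitaryModel ρ) (r₁ c₁ r₂ c₂ r₃ c₃ r₄ c₄ : Fin N)
    (h : ¬((c₁ = c₃ ∧ c₂ = c₄) ∨ (c₁ = c₄ ∧ c₂ = c₃))) :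
    ∫ g, 𝔪 (ρ g) r₁ c₁ r₂ c₂ r₃ c₃ r₄ c₄ ∂haarProbability G = 0 := by
  by_cases h12 : c₂ = c₁
  · subst h12
    by_cases h31 : c₃ = c₂
    · subst h31
      have h4 : c₄ ≠ c₃ := fun h4 => h (Or.inl ⟨rfl, h4.symm⟩)
      refine integral_mono_eq_zero_of_colTwist ρ hρ (Ne.symm h4) r₁ c₃ r₂ c₃ r₃ c₃ r₄ c₄ ?_
      simp only [↓reduceIte, h4]; omega
    · have h13 : c₂ ≠ c₃ := fun h' => h31 h'.symm
      by_cases h42 : c₄ = c₂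
      · subst h42
        refine integral_mono_eq_zero_of_colTwist ρ hρ h13 r₁ c₄ r₂ c₄ r₃ c₃ r₄ c₄ ?_
        simp only [↓reduceIte, h31]; omega
      · by_cases h43 : c₄ = c₃
        · subst h43
          refine integral_mono_eq_zero_of_colTwist ρ hρ h13 r₁ c₂ r₂ c₂ r₃ c₄ r₄ c₄ ?_
          simp only [↓reduceIte, h31]; omega
        · refine integral_mono_eq_zero_of_colTwist ρ hρ h13 r₁ c₂ r₂ c₂ r₃ c₃ r₄ c₄ ?_
          simp only [↓reduceIte, h31, h42, h43]; omega
  · by_cases h31 : c₃ = c₁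
    · subst h31
      have h42 : c₄ ≠ c₂ := fun h' => h (Or.inl ⟨rfl, h'.symm⟩)
      have h24 : c₂ ≠ c₄ := fun h' => h42 h'.symm
      by_cases h41 : c₄ = c₃
      · subst h41
        refine integral_mono_eq_zero_of_colTwist ρ hρ h24 r₁ c₄ r₂ c₂ r₃ c₄ r₄ c₄ ?_
        simp only [↓reduceIte, h42]; omega
      · have h14 : c₃ ≠ c₄ := fun h' => h41 h'.symm
        have h12' : c₃ ≠ c₂ := fun h' => h12 h'.symm
        refine integral_mono_eq_zero_of_colTwist ρ hρ h24 r₁ c₃ r₂ c₂ r₃ c₃ r₄ c₄ ?_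
        simp only [↓reduceIte, h42, h14, h12']; omega
    · by_cases h41 : c₄ = c₁
      · subst h41
        have h32 : c₃ ≠ c₂ := fun h' => h (Or.inr ⟨rfl, h'.symm⟩)
        have h23 : c₂ ≠ c₃ := fun h' => h32 h'.symm
        have h42 : c₄ ≠ c₂ := fun h' => h12 h'.symm
        have h43 : c₄ ≠ c₃ := fun h' => h31 h'.symm
        refine integral_mono_eq_zero_of_colTwist ρ hρ h23 r₁ c₄ r₂ c₂ r₃ c₃ r₄ c₄ ?_
        simp only [↓reduceIte, h32, h42, h43]; omega
      · have h13 : c₁ ≠ c₃ := fun h' => h31 h'.symm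
        by_cases h23 : c₂ = c₃
        · subst h23
          by_cases h42 : c₄ = c₂
          · subst h42
            refine integral_mono_eq_zero_of_colTwist ρ hρ h13 r₁ c₁ r₂ c₄ r₃ c₄ r₄ c₄ ?_
            simp only [↓reduceIte, h12]; omega
          · refine integral_mono_eq_zero_of_colTwist ρ hρ h13 r₁ c₁ r₂ c₂ r₃ c₂ r₄ c₄ ?_
            simp only [↓reduceIte, h12, h41, h42]; omega
        · by_cases h43 : c₄ = c₃
          · subst h43
            refine integral_mono_eq_zero_of_colTwist ρ hρ h13 r₁ c₁ r₂ c₂ r₃ c₄ r₄ c₄ ?_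
            simp only [↓reduceIte, h12, h23, h41]; omega
          · refine integral_mono_eq_zero_of_colTwist ρ hρ h13 r₁ c₁ r₂ c₂ r₃ c₃ r₄ c₄ ?_
            simp only [↓reduceIte, h12, h23, h31, h41, h43]; omega

end Twist

end Summit.QuantumFields.YangMills.Theorems.ToronCumulantSign
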